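import Mathlib
import HarnessLib
import Literature.Analysis.FluidPDE.KochTataru
import Literature.Analysis.FluidPDE.KochTataruKernel
import Literature.Analysis.FluidPDE.KochTataruPointwise
import Literature.Analysis.FluidPDE.NSBoundedMildOseen
import Literature.Analysis.FluidPDE.NSBoundedMildOseenRestart
import Literature.Analysis.FluidPDE.NSBoundedMildSmoothing
import Literature.Analysis.FluidPDE.KNSSMildDecayHorizontal
import Summits.NavierStokesRegularity.NavierStokesRegularity.Theorems.ThreadingFluxPoloidalLiouvillePrecessionOseenTimeLipschitz
import Summits.NavierStokesRegularity.NavierStokesRegularity.Theorems.ThreadingFluxPoloidalLiouvillePrecessionShortPeriodKernel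

/-!
# Route `ThreadingFlux`, item `PoloidalLiouville` (W1, stmt-NavierStokesRegularity-1222) — crux idea «precession-gap» (ns-idea-15), analysis lemma D
# `ShortPeriodCollapse`, PERIOD STEP: for a `P`-periodic bounded measurable field `u` and its time shift `u_h = u(·+h)` at distance `W`,
# `‖B_{t−NP}(u_h,u_h)(t) − B_{t−NP}(u,u)(t)‖ ≤ (4C₀M₀ + 54C_L)·√P·B·W` uniformly in `N ≥ 1`

Cell ns-regularity-ideate, seat ns-poloidal-K2-p2 g13.  Helper file (no stub closed here) for D `ShortPeriodCollapse`.  The Duhamel term from `N` periods in the past is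
split period by period (`Literature.Analysis.FluidPDE.oseenDuhamel_eq_setIntegral_add_oseenDuhamel`):

* NEAR PERIOD `τ ∈ (t−P, t)` (`norm_oseenDuhamel_pair_sub_le_near`): the slice estimate `…ShortPeriodKernel.norm_integral_oseenKernel_pair_sub_le`
  (`≤ 2C₀M₀(t−τ)^{-1/2}BW`) integrated, `∫_{t−P}^t (t−τ)^{-1/2} = 2√P`;
* `k`-TH PAST PERIOD `I_k = (t−(k+1)P, t−kP)`, `k ≥ 1` (`norm_setIntegral_pair_sub_le_far`): FREEZE the kernel time at `kP` — the frozen pieces of `u_h` and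
  `u` COINCIDE, because `τ ↦ ∫K(kP,x−y)[u(τ,y),u(τ,y)]dy` is `P`-periodic and `u_h` is its shift (`Function.Periodic.intervalIntegral_add_eq`); what is
  left is the time-difference slice estimate `…ShortPeriodKernel.norm_integral_oseenKernel_tdiff_pair_sub_le` with `θ = kP ≤ θ′ = t−τ ≤ (k+1)P`:
  `≤ 18C_L·P·(kP)^{-3/2}·B·W` pointwise, `× P` = `18C_L√P·k^{-3/2}·BW`;
* SUM (`norm_oseenDuhamel_pair_sub_le`): induction over `N`, with `Σ_{k≥1} k^{-3/2} ≤ 3` (`sum_Ico_rpow_neg_three_halves_le_three`, telescoping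
  `(k+1)^{-3/2} ≤ 2/√k − 2/√(k+1)`).

This is the «purely-oscillatory gain» of the sketch (`Cruxes/PoloidalLiouville/PrecessionSketch.lean`, file docstring of D): the forcing `u_h⊗u_h − u⊗u` has size
`2BW` AND zero period mean, so each past period costs `k^{-3/2}` instead of `k^{-1/2}`.

WHAT THIS IS NOT: not D (the free term and the contraction are the next file), not the rung F; items 1222 / 27585 OPEN; no claim about Navier–Stokes regularity.
-/

noncomputable section

-- the summit and its single sub-problem share the name (CONVENTIONS §1), as in every Theorems file
set_option linter.dupNamespace false

namespace Summit.NavierStokesRegularity.NavierStokesRegularity.Theorems.ThreadingFluxPoloidalLiouvillePrecessionShortPeriodPieces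

open MeasureTheory Set Function Filter Topology
open scoped RealInnerProductSpace ENNReal
open Literature.Analysis Literature.Analysis.FluidPDE Literature.Analysis.UnboundedOperators
open Summit.NavierStokesRegularity.NavierStokesRegularity.Theorems.ThreadingFluxPoloidalLiouvillePrecessionOseenTimeLipschitz
open Summit.NavierStokesRegularity.NavierStokesRegularity.Theorems.ThreadingFluxPoloidalLiouvillePrecessionShortPeriodKernel

/-! ## A telescoping bound: `Σ_{1 ≤ k < N} k^{-3/2} ≤ 3` -/

/-- The telescoping step: for `a = √n`, `b = √(n+1)` one has `b^{-3} ≤ 2/a − 2/b`, i.e. `(n+1)^{-3/2} ≤ 2/√n − 2/√(n+1)` (`n ≥ 1`). [folklore] -/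
theorem rpow_neg_three_halves_le_telescope {n : ℝ} (hn : 1 ≤ n) :
    (n + 1) ^ (-(3 / 2 : ℝ)) ≤ 2 / Real.sqrt n - 2 / Real.sqrt (n + 1) := by
  set a : ℝ := Real.sqrt n with ha
  set b : ℝ := Real.sqrt (n + 1) with hb
  have hn0 : 0 < n := by linarith
  have ha0 : 0 < a := Real.sqrt_pos.2 hn0
  have hb0 : 0 < b := Real.sqrt_pos.2 (by linarith)
  have ha2 : a ^ 2 = n := Real.sq_sqrt hn0.le
  have hb2 : b ^ 2 = n + 1 := Real.sq_sqrt (by linarith)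
  have hab : a ≤ b := Real.sqrt_le_sqrt (by linarith)
  have hprod : (b - a) * (b + a) = 1 := by nlinarith
  have hba : 1 ≤ 2 * b * (b - a) := by nlinarith
  have key : a ≤ 2 * b ^ 2 * (b - a) := by nlinarith
  have hval : (n + 1) ^ (-(3 / 2 : ℝ)) = 1 / b ^ 3 := by
    rw [rpow_neg_three_halves (by linarith), ← hb]
    rw [show (n + 1) * b = b ^ 3 by rw [← hb2]; ring]
  rw [hval]
  have hrepr : 2 / a - 2 / b - 1 / b ^ 3 = (2 * b ^ 2 * (b - a) - a) / (a * b ^ 3) := by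
    field_simp
  have : 0 ≤ 2 / a - 2 / b - 1 / b ^ 3 := by
    rw [hrepr]; exact div_nonneg (by linarith) (by positivity)
  linarith

/-- `Σ_{k=1}^{n+1} k^{-3/2} ≤ 3 − 2/√(n+1)`. [folklore] -/
theorem sum_Ico_rpow_neg_three_halves_le (n : ℕ) :
    ∑ k ∈ Finset.Ico 1 (n + 2), ((k : ℕ) : ℝ) ^ (-(3 / 2 : ℝ)) ≤ 3 - 2 / Real.sqrt ((n : ℝ) + 1) := by
  induction n with
  | zero =>
    simp [Real.sqrt_one]
    norm_num
  | succ m ih =>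
    rw [Finset.sum_Ico_succ_top (by omega)]
    · have hstep := rpow_neg_three_halves_le_telescope (n := (m : ℝ) + 1) (by have : (0:ℝ) ≤ m := Nat.cast_nonneg m; linarith)
      have hcast : (((m + 2 : ℕ) : ℝ)) = (m : ℝ) + 1 + 1 := by push_cast; ring
      have hcast2 : ((m + 1 : ℕ) : ℝ) + 1 = (m : ℝ) + 1 + 1 := by push_cast; ring
      rw [hcast, hcast2]
      linarith [ih, hstep]

/-- **`Σ_{1 ≤ k < N} k^{-3/2} ≤ 3`** for every `N`. [folklore] -/
theorem sum_Ico_rpow_neg_three_halves_le_three (N : ℕ) :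
    ∑ k ∈ Finset.Ico 1 N, ((k : ℕ) : ℝ) ^ (-(3 / 2 : ℝ)) ≤ 3 := by
  rcases Nat.lt_or_ge N 2 with hN | hN
  · interval_cases N <;> simp
  · obtain ⟨n, rfl⟩ := Nat.exists_eq_add_of_le' hN
    have h := sum_Ico_rpow_neg_three_halves_le n
    have : 0 ≤ 2 / Real.sqrt ((n : ℝ) + 1) := by positivity
    linarith

/-- `∫_{(t−P, t)} (t − τ)^{-1/2} dτ = 2√P` for `P ≥ 0` (substitution `σ = t − τ`, `∫_0^P σ^{-1/2} = 2√P`). [folklore] -/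
theorem setIntegral_Ioo_sub_rpow_neg_half_eq {t P : ℝ} (hP : 0 ≤ P) :
    ∫ τ in Ioo (t - P) t, (t - τ) ^ (-(1 / 2 : ℝ)) = 2 * Real.sqrt P := by
  rw [← integral_Ioc_eq_integral_Ioo, ← intervalIntegral.integral_of_le (by linarith),
    intervalIntegral.integral_comp_sub_left (fun σ : ℝ => σ ^ (-(1 / 2 : ℝ))) t,
    integral_rpow (Or.inl (by norm_num)), sub_sub_cancel, sub_self]
  have h1 : -(1 / 2 : ℝ) + 1 = 1 / 2 := by norm_num
  rw [h1, ← Real.sqrt_eq_rpow, Real.zero_rpow (by norm_num)]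
  ring

/-! ## The Duhamel slices of a bounded measurable field -/

section Slices

variable {u : ℝ → EuclideanSpace ℝ (Fin 3) → EuclideanSpace ℝ (Fin 3)} {B P h W : ℝ}

/-- The time shift `u_h(τ, y) = u(τ + h, y)` of a jointly measurable field is jointly measurable. [folklore] -/
theorem measurable_uncurry_shift (hum : Measurable (uncurry u)) (h : ℝ) :
    Measurable (uncurry fun τ y => u (τ + h) y) := by
  have hm : Measurable fun p : ℝ × EuclideanSpace ℝ (Fin 3) => (p.1 + h, p.2) := (measurable_fst.add_const h).prodMk measurable_snd
  exact hum.comp hm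

/-- A slice `y ↦ u(τ, y)` of a jointly measurable field is measurable. [folklore] -/
theorem measurable_slice (hum : Measurable (uncurry u)) (τ : ℝ) : Measurable (u τ) :=
  hum.comp (measurable_const.prodMk measurable_id)

/-- **The frozen-kernel slice integral is measurable in time**: for fixed `θ, x`, `τ ↦ ∫K(θ,x−y)[u(τ,y),u(τ,y)]dy` is strongly measurable. [folklore] -/
theorem stronglyMeasurable_frozen (hum : Measurable (uncurry u)) (θ : ℝ) (x : EuclideanSpace ℝ (Fin 3)) :
    StronglyMeasurable fun τ : ℝ => ∫ y, oseenKernel θ (x - y) (u τ y) (u τ y) := by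
  have hF : Measurable (fun q : ℝ × EuclideanSpace ℝ (Fin 3) => oseenKernel θ (x - q.2) (uncurry u q) (uncurry u q)) :=
    Measurable.oseenKernel_comp measurable_const (measurable_const.sub measurable_snd) hum hum
  exact hF.stronglyMeasurable.integral_prod_right' (ν := (volume : Measure (EuclideanSpace ℝ (Fin 3))))

/-- **Sup bound of a slice integral**: `‖∫K(θ,x−y)[u(τ,y),u(τ,y)]dy‖ ≤ C₁θ^{-1/2}B²` with the constant of
`Literature.Analysis.FluidPDE.exists_lintegral_enorm_oseenKernel_comp_sub_le_of_bound`. [folklore] -/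
theorem norm_integral_slice_le {C₁ : ℝ} (hC₁ : 0 < C₁)
    (hslice : ∀ {σ : ℝ}, 0 < σ → ∀ {M : ℝ}, 0 ≤ M → ∀ {a b : EuclideanSpace ℝ (Fin 3) → EuclideanSpace ℝ (Fin 3)},
      (∀ y, ‖a y‖ ≤ M) → (∀ y, ‖b y‖ ≤ M) → ∀ x : EuclideanSpace ℝ (Fin 3),
        ∫⁻ y, ‖oseenKernel σ (x - y) (a y) (b y)‖ₑ ≤ ENNReal.ofReal (C₁ * σ ^ (-(1 / 2 : ℝ)) * M ^ 2))
    (hB : 0 ≤ B) (hbd : ∀ τ y, ‖u τ y‖ ≤ B) {θ : ℝ} (hθ : 0 < θ) (τ : ℝ) (x : EuclideanSpace ℝ (Fin 3)) :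
    ‖∫ y, oseenKernel θ (x - y) (u τ y) (u τ y)‖ ≤ C₁ * θ ^ (-(1 / 2 : ℝ)) * B ^ 2 := by
  have hnn : 0 ≤ C₁ * θ ^ (-(1 / 2 : ℝ)) * B ^ 2 := by positivity
  have h := hslice hθ hB (hbd τ) (hbd τ) x
  calc ‖∫ y, oseenKernel θ (x - y) (u τ y) (u τ y)‖
      ≤ (∫⁻ y, ‖oseenKernel θ (x - y) (u τ y) (u τ y)‖ₑ).toReal := by
        have h1 := enorm_integral_le_lintegral_enorm (fun y => oseenKernel θ (x - y) (u τ y) (u τ y)) (μ := volume)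
        have hfin : ∫⁻ y, ‖oseenKernel θ (x - y) (u τ y) (u τ y)‖ₑ ≠ ∞ := ne_top_of_le_ne_top ENNReal.ofReal_ne_top h
        rw [← ofReal_norm] at h1
        exact (ENNReal.ofReal_le_iff_le_toReal hfin).1 h1
    _ ≤ (ENNReal.ofReal (C₁ * θ ^ (-(1 / 2 : ℝ)) * B ^ 2)).toReal := ENNReal.toReal_mono ENNReal.ofReal_ne_top h
    _ = C₁ * θ ^ (-(1 / 2 : ℝ)) * B ^ 2 := ENNReal.toReal_ofReal hnn

/-- The frozen-kernel slice integral is integrable on every bounded time interval. [folklore] -/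
theorem integrableOn_frozen {C₁ : ℝ} (hC₁ : 0 < C₁)
    (hslice : ∀ {σ : ℝ}, 0 < σ → ∀ {M : ℝ}, 0 ≤ M → ∀ {a b : EuclideanSpace ℝ (Fin 3) → EuclideanSpace ℝ (Fin 3)},
      (∀ y, ‖a y‖ ≤ M) → (∀ y, ‖b y‖ ≤ M) → ∀ x : EuclideanSpace ℝ (Fin 3),
        ∫⁻ y, ‖oseenKernel σ (x - y) (a y) (b y)‖ₑ ≤ ENNReal.ofReal (C₁ * σ ^ (-(1 / 2 : ℝ)) * M ^ 2))
    (hum : Measurable (uncurry u)) (hB : 0 ≤ B) (hbd : ∀ τ y, ‖u τ y‖ ≤ B) {θ : ℝ} (hθ : 0 < θ)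
    (x : EuclideanSpace ℝ (Fin 3)) (s₀ s₁ : ℝ) :
    IntegrableOn (fun τ : ℝ => ∫ y, oseenKernel θ (x - y) (u τ y) (u τ y)) (Ioo s₀ s₁) :=
  Measure.integrableOn_of_bounded (M := C₁ * θ ^ (-(1 / 2 : ℝ)) * B ^ 2) (measure_Ioo_lt_top.ne)
    (stronglyMeasurable_frozen hum θ x).aestronglyMeasurable
    (ae_of_all _ fun τ => norm_integral_slice_le hC₁ hslice hB hbd hθ τ x)

/-- **The frozen pieces of `u_h` and `u` coincide** (periodicity): for `u` `P`-periodic in time, the interval of length `P` starting at `a`, and any `h`,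
`∫_{(a, a+P)} ∫K(θ,x−y)[u(τ+h,y),u(τ+h,y)]dy dτ = ∫_{(a, a+P)} ∫K(θ,x−y)[u(τ,y),u(τ,y)]dy dτ`. [folklore] -/
theorem setIntegral_frozen_shift_eq (hper : ∀ τ y, u (τ + P) y = u τ y) (hP : 0 < P) (θ : ℝ) (x : EuclideanSpace ℝ (Fin 3))
    (a h : ℝ) :
    ∫ τ in Ioo a (a + P), ∫ y, oseenKernel θ (x - y) (u (τ + h) y) (u (τ + h) y) =
      ∫ τ in Ioo a (a + P), ∫ y, oseenKernel θ (x - y) (u τ y) (u τ y) := by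
  set g : ℝ → EuclideanSpace ℝ (Fin 3) := fun τ => ∫ y, oseenKernel θ (x - y) (u τ y) (u τ y) with hg
  have hgper : Function.Periodic g P := fun τ => by
    simp only [hg]
    refine integral_congr_ae (ae_of_all _ fun y => ?_)
    show oseenKernel θ (x - y) (u (τ + P) y) (u (τ + P) y) = oseenKernel θ (x - y) (u τ y) (u τ y)
    rw [hper]
  have h1 : ∫ τ in Ioo a (a + P), g (τ + h) = ∫ τ in a..a + P, g (τ + h) := by
    rw [intervalIntegral.integral_of_le (by linarith), integral_Ioc_eq_integral_Ioo]
  have h2 : ∫ τ in Ioo a (a + P), g τ = ∫ τ in a..a + P, g τ := by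
    rw [intervalIntegral.integral_of_le (by linarith), integral_Ioc_eq_integral_Ioo]
  change ∫ τ in Ioo a (a + P), g (τ + h) = ∫ τ in Ioo a (a + P), g τ
  rw [h1, h2, intervalIntegral.integral_comp_add_right g h, show a + P + h = a + h + P by ring]
  exact hgper.intervalIntegral_add_eq (a + h) a

/-- **Far period**: for `k ≥ 1`, `u` bounded by `B`, `P`-periodic, jointly measurable, `‖u(τ+h,y) − u(τ,y)‖ ≤ W`, the `k`-th past period of the Duhamel
difference is `≤ 18·C_L·P²·(kP)^{-3/2}·B·W`. [folklore] -/
theorem norm_setIntegral_pair_sub_le_far {C_L C₁ : ℝ} (hCL : 0 ≤ C_L) (hC₁ : 0 < C₁)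
    (hP1 : ∀ θ θ' : ℝ, 0 < θ → θ ≤ θ' → ∀ a b : EuclideanSpace ℝ (Fin 3),
      ∫ z, ‖oseenKernel θ' z a b - oseenKernel θ z a b‖ ≤ C_L * (θ' - θ) * θ ^ (-(3 / 2 : ℝ)) * ‖a‖ * ‖b‖)
    (hslice : ∀ {σ : ℝ}, 0 < σ → ∀ {M : ℝ}, 0 ≤ M → ∀ {a b : EuclideanSpace ℝ (Fin 3) → EuclideanSpace ℝ (Fin 3)},
      (∀ y, ‖a y‖ ≤ M) → (∀ y, ‖b y‖ ≤ M) → ∀ x : EuclideanSpace ℝ (Fin 3),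
        ∫⁻ y, ‖oseenKernel σ (x - y) (a y) (b y)‖ₑ ≤ ENNReal.ofReal (C₁ * σ ^ (-(1 / 2 : ℝ)) * M ^ 2))
    (hum : Measurable (uncurry u)) (hB : 0 ≤ B) (hbd : ∀ τ y, ‖u τ y‖ ≤ B) (hP : 0 < P)
    (hper : ∀ τ y, u (τ + P) y = u τ y) (hW : 0 ≤ W) (hw : ∀ τ y, ‖u (τ + h) y - u τ y‖ ≤ W)
    {k : ℕ} (hk : 1 ≤ k) (t : ℝ) (x : EuclideanSpace ℝ (Fin 3)) :
    ‖(∫ τ in Ioo (t - (k + 1) * P) (t - k * P), ∫ y, oseenKernel (1 * (t - τ)) (x - y) (u (τ + h) y) (u (τ + h) y)) -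
        ∫ τ in Ioo (t - (k + 1) * P) (t - k * P), ∫ y, oseenKernel (1 * (t - τ)) (x - y) (u τ y) (u τ y)‖ ≤
      18 * C_L * P ^ 2 * ((k : ℝ) * P) ^ (-(3 / 2 : ℝ)) * B * W := by
  have hk0 : (1 : ℝ) ≤ k := by exact_mod_cast hk
  have hθ : 0 < (k : ℝ) * P := by positivity
  set a : ℝ := t - (k + 1) * P with ha
  have hI : t - k * P = a + P := by rw [ha]; ring
  have humh := measurable_uncurry_shift hum h
  have hbdh : ∀ τ y, ‖u (τ + h) y‖ ≤ B := fun τ y => hbd _ _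
  -- the four slice functions and their integrability on the period
  have hf : IntegrableOn (fun τ => ∫ y, oseenKernel (1 * (t - τ)) (x - y) (u τ y) (u τ y)) (Ioo a (a + P)) :=
    integrableOn_integral_oseenKernel_slab one_pos hum hbd (by linarith) (by rw [← hI]; nlinarith) x
  have hfh : IntegrableOn (fun τ => ∫ y, oseenKernel (1 * (t - τ)) (x - y) (u (τ + h) y) (u (τ + h) y)) (Ioo a (a + P)) :=
    integrableOn_integral_oseenKernel_slab (w := fun τ y => u (τ + h) y) one_pos humh hbdh (by linarith) (by rw [← hI]; nlinarith) x
  have hg : IntegrableOn (fun τ => ∫ y, oseenKernel ((k : ℝ) * P) (x - y) (u τ y) (u τ y)) (Ioo a (a + P)) :=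
    integrableOn_frozen hC₁ hslice hum hB hbd hθ x a (a + P)
  have hgh : IntegrableOn (fun τ => ∫ y, oseenKernel ((k : ℝ) * P) (x - y) (u (τ + h) y) (u (τ + h) y)) (Ioo a (a + P)) :=
    integrableOn_frozen (u := fun τ y => u (τ + h) y) hC₁ hslice humh hB hbdh hθ x a (a + P)
  have hfrozen := setIntegral_frozen_shift_eq hper hP ((k : ℝ) * P) x a h
  rw [hI]
  -- subtract the (equal) frozen pieces
  have hA : IntegrableOn (fun τ => (∫ y, oseenKernel (1 * (t - τ)) (x - y) (u (τ + h) y) (u (τ + h) y)) -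
      ∫ y, oseenKernel ((k : ℝ) * P) (x - y) (u (τ + h) y) (u (τ + h) y)) (Ioo a (a + P)) := hfh.sub hgh
  have hB' : IntegrableOn (fun τ => (∫ y, oseenKernel (1 * (t - τ)) (x - y) (u τ y) (u τ y)) -
      ∫ y, oseenKernel ((k : ℝ) * P) (x - y) (u τ y) (u τ y)) (Ioo a (a + P)) := hf.sub hg
  have hrew : (∫ τ in Ioo a (a + P), ∫ y, oseenKernel (1 * (t - τ)) (x - y) (u (τ + h) y) (u (τ + h) y)) -
      (∫ τ in Ioo a (a + P), ∫ y, oseenKernel (1 * (t - τ)) (x - y) (u τ y) (u τ y)) =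
      ∫ τ in Ioo a (a + P), (((∫ y, oseenKernel (1 * (t - τ)) (x - y) (u (τ + h) y) (u (τ + h) y)) -
          ∫ y, oseenKernel ((k : ℝ) * P) (x - y) (u (τ + h) y) (u (τ + h) y)) -
        ((∫ y, oseenKernel (1 * (t - τ)) (x - y) (u τ y) (u τ y)) - ∫ y, oseenKernel ((k : ℝ) * P) (x - y) (u τ y) (u τ y))) := by
    rw [integral_sub hA hB', integral_sub hfh hgh, integral_sub hf hg, hfrozen]
    abel
  rw [hrew]
  -- pointwise far-period slice estimate, then the length `P` of the period
  have hpt : ∀ τ ∈ Ioo a (a + P),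
      ‖((∫ y, oseenKernel (1 * (t - τ)) (x - y) (u (τ + h) y) (u (τ + h) y)) -
          ∫ y, oseenKernel ((k : ℝ) * P) (x - y) (u (τ + h) y) (u (τ + h) y)) -
        ((∫ y, oseenKernel (1 * (t - τ)) (x - y) (u τ y) (u τ y)) - ∫ y, oseenKernel ((k : ℝ) * P) (x - y) (u τ y) (u τ y))‖ ≤
      18 * C_L * P * ((k : ℝ) * P) ^ (-(3 / 2 : ℝ)) * B * W := by
    intro τ hτ
    have hτ1 : (k : ℝ) * P ≤ 1 * (t - τ) := by rw [ha] at hτ; have := hτ.2; nlinarith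
    have hτ2 : 1 * (t - τ) - (k : ℝ) * P ≤ P := by rw [ha] at hτ; have := hτ.1; nlinarith
    have h := norm_integral_oseenKernel_tdiff_pair_sub_le hP1 hθ hτ1 hB hW
      (measurable_slice hum τ).aemeasurable (measurable_slice humh τ).aemeasurable (hbd τ) (hbdh τ) (hw τ) x
    refine h.trans ?_
    have hnn : 0 ≤ 18 * C_L * ((k : ℝ) * P) ^ (-(3 / 2 : ℝ)) * B * W := by positivity
    calc 18 * C_L * (1 * (t - τ) - (k : ℝ) * P) * ((k : ℝ) * P) ^ (-(3 / 2 : ℝ)) * B * W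
        = (1 * (t - τ) - (k : ℝ) * P) * (18 * C_L * ((k : ℝ) * P) ^ (-(3 / 2 : ℝ)) * B * W) := by ring
      _ ≤ P * (18 * C_L * ((k : ℝ) * P) ^ (-(3 / 2 : ℝ)) * B * W) := mul_le_mul_of_nonneg_right hτ2 hnn
      _ = 18 * C_L * P * ((k : ℝ) * P) ^ (-(3 / 2 : ℝ)) * B * W := by ring
  have hvol : volume (Ioo a (a + P)) < ∞ := measure_Ioo_lt_top
  have h := norm_setIntegral_le_of_norm_le_const hvol hpt
  rw [Real.volume_real_Ioo_of_le (by linarith), show a + P - a = P by ring] at h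
  refine h.trans (le_of_eq ?_)
  ring

/-- **Near period**: the last period `(t−P, t)` of the Duhamel difference is `≤ 4·C₀M₀·√P·B·W`. [folklore] -/
theorem norm_oseenDuhamel_pair_sub_le_near {C₀ : ℝ} (hC₀ : 0 ≤ C₀)
    (hK : ∀ ⦃σ : ℝ⦄, 0 < σ → ∀ z a b : EuclideanSpace ℝ (Fin 3),
      ‖oseenKernel σ z a b‖ ≤ C₀ * (σ + ‖z‖ ^ 2) ^ (-(2 : ℝ)) * ‖a‖ * ‖b‖)
    (hum : Measurable (uncurry u)) (hB : 0 ≤ B) (hbd : ∀ τ y, ‖u τ y‖ ≤ B) (hP : 0 < P)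
    (hW : 0 ≤ W) (hw : ∀ τ y, ‖u (τ + h) y - u τ y‖ ≤ W) (t : ℝ) (x : EuclideanSpace ℝ (Fin 3)) :
    ‖oseenDuhamel 1 (t - P) (fun τ y => u (τ + h) y) (fun τ y => u (τ + h) y) t x - oseenDuhamel 1 (t - P) u u t x‖ ≤
      4 * C₀ * (∫ w : EuclideanSpace ℝ (Fin 3), (1 + ‖w‖ ^ 2) ^ (-(2 : ℝ))) * Real.sqrt P * B * W := by
  set M₀ : ℝ := ∫ w : EuclideanSpace ℝ (Fin 3), (1 + ‖w‖ ^ 2) ^ (-(2 : ℝ)) with hM₀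
  have he : (Module.finrank ℝ (EuclideanSpace ℝ (Fin 3)) : ℝ) < 2 * 2 := by
    rw [finrank_real_euclideanSpace_fin_three]; norm_num
  have hM₀pos : 0 < M₀ := integral_one_add_norm_sq_rpow_neg_pos he
  have humh := measurable_uncurry_shift hum h
  have hbdh : ∀ τ y, ‖u (τ + h) y‖ ≤ B := fun τ y => hbd _ _
  have hst : t - P < t := by linarith
  have hf : IntegrableOn (fun τ => ∫ y, oseenKernel (1 * (t - τ)) (x - y) (u τ y) (u τ y)) (Ioo (t - P) t) :=
    integrableOn_integral_oseenKernel_slab one_pos hum hbd hst le_rfl x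
  have hfh : IntegrableOn (fun τ => ∫ y, oseenKernel (1 * (t - τ)) (x - y) (u (τ + h) y) (u (τ + h) y)) (Ioo (t - P) t) :=
    integrableOn_integral_oseenKernel_slab (w := fun τ y => u (τ + h) y) one_pos humh hbdh hst le_rfl x
  rw [oseenDuhamel_apply, oseenDuhamel_apply, ← integral_sub hfh hf]
  have hpt : ∀ᵐ τ ∂(volume.restrict (Ioo (t - P) t)),
      ‖(∫ y, oseenKernel (1 * (t - τ)) (x - y) (u (τ + h) y) (u (τ + h) y)) -
          ∫ y, oseenKernel (1 * (t - τ)) (x - y) (u τ y) (u τ y)‖ ≤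
        (2 * C₀ * M₀ * B * W) * (t - τ) ^ (-(1 / 2 : ℝ)) := by
    refine (ae_restrict_mem measurableSet_Ioo).mono fun τ hτ => ?_
    have hσ : 0 < 1 * (t - τ) := by rw [one_mul]; exact sub_pos.2 hτ.2
    have h := norm_integral_oseenKernel_pair_sub_le hC₀ hK hσ hB hW
      (measurable_slice hum τ).aemeasurable (measurable_slice humh τ).aemeasurable (hbd τ) (hbdh τ) (hw τ) x
    refine h.trans (le_of_eq ?_)
    rw [hM₀, one_mul]; ring
  have hgint : IntegrableOn (fun τ => (2 * C₀ * M₀ * B * W) * (t - τ) ^ (-(1 / 2 : ℝ))) (Ioo (t - P) t) :=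
    (integrableOn_Ioo_rpow_neg_half_sub (t - P) t).const_mul _
  calc _ ≤ ∫ τ in Ioo (t - P) t, (2 * C₀ * M₀ * B * W) * (t - τ) ^ (-(1 / 2 : ℝ)) := norm_integral_le_of_norm_le hgint hpt
    _ = (2 * C₀ * M₀ * B * W) * (2 * Real.sqrt P) := by
        rw [integral_const_mul, setIntegral_Ioo_sub_rpow_neg_half_eq hP.le]
    _ = 4 * C₀ * M₀ * Real.sqrt P * B * W := by ring

/-- **All periods**: for every `N ≥ 1`, `‖B_{t−NP}(u_h,u_h)(t) − B_{t−NP}(u,u)(t)‖ ≤ (4C₀M₀ + 54C_L)·√P·B·W` (near period + `Σ_{k=1}^{N−1}` far periods,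
`Σ k^{-3/2} ≤ 3`). [folklore] -/
theorem norm_oseenDuhamel_pair_sub_le {C₀ C_L C₁ : ℝ} (hC₀ : 0 ≤ C₀) (hCL : 0 ≤ C_L) (hC₁ : 0 < C₁)
    (hK : ∀ ⦃σ : ℝ⦄, 0 < σ → ∀ z a b : EuclideanSpace ℝ (Fin 3),
      ‖oseenKernel σ z a b‖ ≤ C₀ * (σ + ‖z‖ ^ 2) ^ (-(2 : ℝ)) * ‖a‖ * ‖b‖)
    (hP1 : ∀ θ θ' : ℝ, 0 < θ → θ ≤ θ' → ∀ a b : EuclideanSpace ℝ (Fin 3),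
      ∫ z, ‖oseenKernel θ' z a b - oseenKernel θ z a b‖ ≤ C_L * (θ' - θ) * θ ^ (-(3 / 2 : ℝ)) * ‖a‖ * ‖b‖)
    (hslice : ∀ {σ : ℝ}, 0 < σ → ∀ {M : ℝ}, 0 ≤ M → ∀ {a b : EuclideanSpace ℝ (Fin 3) → EuclideanSpace ℝ (Fin 3)},
      (∀ y, ‖a y‖ ≤ M) → (∀ y, ‖b y‖ ≤ M) → ∀ x : EuclideanSpace ℝ (Fin 3),
        ∫⁻ y, ‖oseenKernel σ (x - y) (a y) (b y)‖ₑ ≤ ENNReal.ofReal (C₁ * σ ^ (-(1 / 2 : ℝ)) * M ^ 2))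
    (hum : Measurable (uncurry u)) (hB : 0 ≤ B) (hbd : ∀ τ y, ‖u τ y‖ ≤ B) (hP : 0 < P)
    (hper : ∀ τ y, u (τ + P) y = u τ y) (hW : 0 ≤ W) (hw : ∀ τ y, ‖u (τ + h) y - u τ y‖ ≤ W)
    {N : ℕ} (hN : 1 ≤ N) (t : ℝ) (x : EuclideanSpace ℝ (Fin 3)) :
    ‖oseenDuhamel 1 (t - N * P) (fun τ y => u (τ + h) y) (fun τ y => u (τ + h) y) t x - oseenDuhamel 1 (t - N * P) u u t x‖ ≤
      (4 * C₀ * (∫ w : EuclideanSpace ℝ (Fin 3), (1 + ‖w‖ ^ 2) ^ (-(2 : ℝ))) + 54 * C_L) * Real.sqrt P * B * W := by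
  set M₀ : ℝ := ∫ w : EuclideanSpace ℝ (Fin 3), (1 + ‖w‖ ^ 2) ^ (-(2 : ℝ)) with hM₀
  have he : (Module.finrank ℝ (EuclideanSpace ℝ (Fin 3)) : ℝ) < 2 * 2 := by
    rw [finrank_real_euclideanSpace_fin_three]; norm_num
  have hM₀pos : 0 < M₀ := integral_one_add_norm_sq_rpow_neg_pos he
  have humh := measurable_uncurry_shift hum h
  have hbdh : ∀ τ y, ‖u (τ + h) y‖ ≤ B := fun τ y => hbd _ _
  have hsqrt : 0 < Real.sqrt P := Real.sqrt_pos.2 hP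
  -- induction with the running sum of `k^{-3/2}`
  have main : ∀ n : ℕ, ‖oseenDuhamel 1 (t - (n + 1 : ℕ) * P) (fun τ y => u (τ + h) y) (fun τ y => u (τ + h) y) t x -
      oseenDuhamel 1 (t - (n + 1 : ℕ) * P) u u t x‖ ≤
      4 * C₀ * M₀ * Real.sqrt P * B * W +
        18 * C_L * Real.sqrt P * B * W * ∑ k ∈ Finset.Ico 1 (n + 1), ((k : ℕ) : ℝ) ^ (-(3 / 2 : ℝ)) := by
    intro n
    induction n with
    | zero =>
      simp only [Nat.zero_add, Nat.cast_one, one_mul, Finset.Ico_self, Finset.sum_empty, mul_zero, add_zero]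
      exact norm_oseenDuhamel_pair_sub_le_near hC₀ hK hum hB hbd hP hW hw t x
    | succ m ih =>
      have hm1 : (1 : ℝ) ≤ (m + 1 : ℕ) := by exact_mod_cast Nat.succ_pos m
      have hs₀ : t - ((m + 1 + 1 : ℕ) : ℝ) * P < t - ((m + 1 : ℕ) : ℝ) * P := by push_cast; nlinarith
      have hs : t - ((m + 1 : ℕ) : ℝ) * P < t := by nlinarith
      rw [oseenDuhamel_eq_setIntegral_add_oseenDuhamel (w := fun τ y => u (τ + h) y) one_pos humh hbdh hs₀ hs x,
        oseenDuhamel_eq_setIntegral_add_oseenDuhamel one_pos hum hbd hs₀ hs x, add_sub_add_comm]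
      refine (norm_add_le _ _).trans ?_
      have hfar := norm_setIntegral_pair_sub_le_far hCL hC₁ hP1 hslice hum hB hbd hP hper hW hw (k := m + 1) (by omega) t x
      have hcast : ((m + 1 + 1 : ℕ) : ℝ) = ((m + 1 : ℕ) : ℝ) + 1 := by push_cast; ring
      rw [hcast] at ⊢
      rw [Finset.sum_Ico_succ_top (by omega), mul_add]
      have hkey : 18 * C_L * P ^ 2 * ((((m + 1 : ℕ) : ℝ)) * P) ^ (-(3 / 2 : ℝ)) * B * W =
          18 * C_L * Real.sqrt P * B * W * (((m + 1 : ℕ) : ℝ)) ^ (-(3 / 2 : ℝ)) := by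
        rw [Real.mul_rpow (by positivity) hP.le]
        have hP32 : P ^ 2 * P ^ (-(3 / 2 : ℝ)) = Real.sqrt P := by
          rw [Real.sqrt_eq_rpow, show (P ^ 2 : ℝ) = P ^ (2 : ℝ) by norm_cast, ← Real.rpow_add hP]; norm_num
        calc 18 * C_L * P ^ 2 * ((((m + 1 : ℕ) : ℝ)) ^ (-(3 / 2 : ℝ)) * P ^ (-(3 / 2 : ℝ))) * B * W
            = 18 * C_L * (P ^ 2 * P ^ (-(3 / 2 : ℝ))) * B * W * (((m + 1 : ℕ) : ℝ)) ^ (-(3 / 2 : ℝ)) := by ring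
          _ = _ := by rw [hP32]
      rw [hkey] at hfar
      linarith [hfar, ih]
  obtain ⟨n, rfl⟩ : ∃ n, N = n + 1 := ⟨N - 1, by omega⟩
  refine (main n).trans ?_
  have hS := sum_Ico_rpow_neg_three_halves_le_three (n + 1)
  have hc : 0 ≤ 18 * C_L * Real.sqrt P * B * W := by positivity
  nlinarith [mul_le_mul_of_nonneg_left hS hc]

end Slices

end Summit.NavierStokesRegularity.NavierStokesRegularity.Theorems.ThreadingFluxPoloidalLiouvillePrecessionShortPeriodPieces

end
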